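import Summits.QuantumFields.YangMills.Theorems.BalabanUVNodesN15CurvedGluingSmoothCutDressedFarDefect
import Summits.QuantumFields.YangMills.Theorems.BalabanUVNodesN15CurvedGluingCubeSmoothCutDressedDefect
import Summits.QuantumFields.YangMills.Theorems.BalabanUVNodesN15NeumannCubeGradientDefect
import HarnessLib

/-!
# Route «BalabanUVNodes» (cluster K4 «SpineRates»), Track-A DAG node N15 = NE2, BACKGROUND LAYER — THE FAR DEFECT OF A STRUCTURAL PERTURBATION, ONE GRID AND TWO GRIDS: for `V̂_f = unstackM C A + N_V∘pr₀`
# (local species + a nonlocal operator on the propagator component, dag-n15-w5's structural shape) the far part is `((1 − M_ψ)N_VM_χ)∘pr₀` — the species has none — so the far-defect rows of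
# the per-cube-gauge capstones AND THEIR TWO-GRID η-DEFECTS (`…GluedDefectGauged`'s `hDFK`, `hDFX`) come from the far letter of `N_V` and its two-grid defect alone

Cell `pub-ymgap`, seat `pub-ymgap-dag-n15-w3` (WIDTH SEAT 3∕3 on node N15, director-ym №197 ∕ HUMAN RULING D-0149; plan `W-SEAT-START-LIST.md` §n15 item 3 «LG-vector + background layers at
GENERAL small-field U» — fiftieth piece; the two-grid producer side of the far-defect slots of this seat's g5 capstones p637871 ∕ p639415).  `bears_on: R4∕N15 · K3⁸ SpineGivenEndpointR13SepCoPHV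
(stmt-QuantumFields-27366; K3⁷ 20544 aside — KEY MAP v2)`.  Filed `--kind proof --supports stmt-QuantumFields-27366 --as helper` — COUNT-NEUTRAL.  Theorems only; 0 `def`, 0 `sorry`.  Imports
BY NAME this seat's `…SmoothCutDressedFarDefect` (`jetCut_comp_jet_mulOp_comp`, `jet_comp_eq_stack`, `mulOp_comp_farDefect_comp_dressed`, `commOp_farDefect_comp_dressed_eq`) and file 35
`…SmoothCutDressedDefect` (`hasMaj_idef_smoothCutDressed_loc₂`; through it file 34's rows, file 23 `hasMaj_dressedV_pair`, B1b `unstackM`, B2 `projO` ∕ `projO_none_comp_stack`, lit `idef_comp` ∕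
`idef_zero` ∕ `hasMaj_idef_mulOp`, dag-n15-c `hasMaj_comp_exp_in` ∕ `hasMaj_diag_comp`, file 22 `mulOp_fst_comm_mmulOp`); nothing in the tree is modified, no landed name re-declared.

WHY.  File 49 inhabited the far-defect slot of the one-grid capstone from ONE far letter `(1 − M_ψ)V̂_fC_χ ≤ θ_Fe^{−ρ_Fd}` of the full perturbation.  NE2 is a RATE, so the two-grid capstone
(`hasMaj_idef_glueInv_smoothCutDressed_localGauges`) needs the η-DEFECTS of the far-defect rows too.  For the perturbations the lineage actually builds — dag-n15-w5's structural shape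
`V̂_f = unstackM C A + N_V∘pr₀` (Bałaban's local species (3.52) plus the nonlocal `P₁(A)` of (3.76)–(3.77) acting on the propagator component) — the far part simplifies EXACTLY: the species is
local in the lattice factor (`unstackM C A∘C_χ = M_χ∘unstackM C A`), so `(1 − M_ψ)V̂_fC_χ = ((1 − M_ψ)N_VM_χ)∘pr₀` when `ψχ = χ` (★ `farPart_structural`), and since `pr₀∘jet = 1` the remainder row
is ★ `commOp_farDefect_structural_eq`: `[F, M_h]X = −((1 − M_ψ)N_VM_χ)∘(M_hX)` — the far part of the NONLOCAL summand against the partition-cut propagator.  Hence: ★★ `hasMaj_commOp_farDefect_structural`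
(one grid: `[F, M_h]X ≤ 1_S(y′)(θ_FB̄′c_r)e^{−ρ₃d}` from `(1 − M_ψ)N_VM_χ ≤ θ_Fe^{−ρ_Fd}`, no derivative letter of the partition); ★★★ `hasMaj_idef_commOp_farDefect_structural` (two grids, the
`hDFK` row of p639415: three-factor Leibniz `𝔇(T′₁M_{h′}X′, T₁M_hX) = T′₁(M_{h′}𝔇(X′,X) + 𝔇(M_{h′},M_h)X) + 𝔇(T′₁,T₁)M_hX` with file 35's `𝔇(X′,X)`, file 34's `X`, the partition fit `o`, the
fine far letter `θ_F` and the displayed two-grid defect `𝔇(T′₁, T₁) ≤ r_Fe^{−ρ_Fd}` of the far parts: `≤ 1_S(y′)((θ_F(A_D + oB̄′) + r_FB̄′)c_r)e^{−ρ₃d}`); ★ `hasMaj_idef_mulOp_farDefect_structural`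
(the `hDFX` row: both `M_hFX` vanish, `r_{FE} = 0`).  Transport lemmas `hasMaj_of_eq_neg_comp`, `hasMaj_idef_of_eq_neg_comp₃`, `hasMaj_idef_of_eq_zero` carry rows along the exact
identities without rewriting inside the cube terms (dag-n15-a `TwoGrid.idef_neg_neg` BY NAME).  PLUG-IN for p639415: `hFK∕hFK′ := hasMaj_commOp_farDefect_structural` (both grids), `hDFK := ★★★`, `hFX∕hFX′ := file 49`, `hDFX := ★`.

HONEST FRAMING ∕ LIMITS.  Finite-dimensional operator algebra + block-majorant bookkeeping over DISPLAYED rows (file 34∕35's cut rows and defects, the partitions' letters∕fits∕support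
insertions, the far letter of `N_V` and its two-grid defect); the nonlocal `N_V`, its far letter and two-grid defect are NOT produced here (located: Bałaban's `P₁(A)` kernel letters
(3.49)∕(3.68)∕(3.77) — lane-held; for the `U ≡ 1` knit dag-n15-a's Landau∕averaging two-grid letters are the nearest objects); nothing of [B5]∕[B6]∕[B9] asserted ((2.93), (2.133)–(2.135),
(3.34)–(3.35), (3.52), (3.63)–(3.65), (3.76)–(3.77), Thm 3.14 = SHAPES ∕ MECHANISM ∕ TEMPLATE).  NE2⁺ NOT PRINTED, NOT proved; N15 NOT discharged; K3⁸ OPEN, skeleton v6 untouched; counts of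
record UNMOVED (typed 28∕28 · discharged 5∕27); one finite 𝕋⁴ at fixed ε — NOT infinite volume, NOT OS on ℝ⁴, NOT a mass gap, NOT Clay; R4 closes the conditional finite-𝕋⁴ rung `BalabanLadder.UV`
only.  Restate-immune (no Theses import).
-/

set_option autoImplicit false

noncomputable section
open scoped BigOperators Matrix
open Finset

namespace Summit.QuantumFields.YangMills.BalabanUVNodes.N15.CurvedSpecies

open Literature.MathematicalPhysics.QuantumFieldTheory.Balaban1983to89
open Literature.MathematicalPhysics.QuantumFieldTheory.Balaban1983to89.B11SectG (BlockNorm HasMaj RowSum hasMaj_comp hasMaj_zero)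
open Literature.MathematicalPhysics.QuantumFieldTheory.Balaban1983to89.B6RandomWalk (Triangle254)
open Literature.MathematicalPhysics.QuantumFieldTheory.Balaban1983to89.B6Prop26Gluing (mulOp mulOp_apply ind ind_nonneg ind_le_one)
open Literature.MathematicalPhysics.QuantumFieldTheory.Balaban1983to89.T4EtaRateDefect (idef idef_apply idef_comp idef_zero)
open Literature.MathematicalPhysics.QuantumFieldTheory.Balaban1983to89.T4EtaRateCoeffDefect (pull diagK diagK_nonneg hasMaj_mulOp hasMaj_idef_mulOp)
open Summit.QuantumFields.YangMills.BalabanUVNodes.N15.MatrixSpecies (mmulOp liftBlk liftMap liftEquiv liftEquiv_apply liftEquiv_symm_apply)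
open Summit.QuantumFields.YangMills.BalabanUVNodes.N15.BackgroundLayer (fgrad bgrad fgradAdj stack projO blkPair liftPair bgPropV stack_apply_none stack_apply_some projO_none_comp_stack unstackM unstackM_apply)
open Summit.QuantumFields.YangMills.BalabanUVNodes.N15.Gluing (commOp lapOp parametrix remainder glueInv hasMaj_diag_comp hasMaj_comp_diag hasMaj_comp_exp_in)

/-! ## §1 Structural perturbations: the far part of `V̂_f = unstackM C A + N_V∘pr₀` is the far part of its NONLOCAL summand on the propagator component -/

section Structural

variable {X ι J : Type} [Fintype ι] [Fintype J] (Cc : X → Matrix ι ι ℝ) (Ac : J → X → Matrix ι ι ℝ) (NV : (X × ι → ℝ) →ₗ[ℝ] (X × ι → ℝ)) (χX ψX : X → ℝ)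

omit [Fintype ι] [Fintype J] in
/-- Components pass through a pair-carrier site cut-off: `pr_j∘C_χ = M_χ∘pr_j`. [folklore] -/
theorem projO_comp_jetCut (j : Option J) : projO j ∘ₗ mulOp (fun q : (X × ι) × Option J => χX q.1.1) = mulOp (fun p : X × ι => χX p.1) ∘ₗ projO j := by
  refine LinearMap.ext fun f => funext fun p => ?_
  simp only [LinearMap.comp_apply, BackgroundLayer.projO_apply, mulOp_apply]

/-- The LOCAL species commutes with the cut: `unstackM C A ∘ C_χ = M_χ ∘ unstackM C A` (range zero in the lattice factor). [cite: Balaban1985BackgroundPropagators, (3.52) p.400 (shape)] -/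
theorem unstackM_comp_jetCut : unstackM Cc Ac ∘ₗ mulOp (fun q : (X × ι) × Option J => χX q.1.1) = mulOp (fun p : X × ι => χX p.1) ∘ₗ unstackM Cc Ac := by
  refine LinearMap.ext fun f => funext fun p => ?_
  simp only [LinearMap.comp_apply, unstackM_apply, mulOp_apply, Finset.mul_sum, mul_add]
  congr 1
  · exact Finset.sum_congr rfl fun j _ => by ring
  · exact Finset.sum_congr rfl fun μ _ => Finset.sum_congr rfl fun j _ => by ring

/-- ★ **THE FAR PART OF A STRUCTURAL PERTURBATION**: for `V̂_f = unstackM C A + N_V∘pr₀` (local species + a nonlocal operator on the propagator component) and `ψχ = χ`: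
`(1 − M_ψ)∘V̂_f∘C_χ = ((1 − M_ψ)∘N_V∘M_χ)∘pr₀` — the species part has no far part. [cite: Balaban1985BackgroundPropagators, (3.52) p.400, (3.76)–(3.77) p.406 (shapes)] -/
theorem farPart_structural (hψχ : mulOp (fun p : X × ι => ψX p.1) ∘ₗ mulOp (fun p : X × ι => χX p.1) = mulOp (fun p : X × ι => χX p.1)) :
    (LinearMap.id - mulOp (fun p : X × ι => ψX p.1)) ∘ₗ (unstackM Cc Ac + NV ∘ₗ projO none) ∘ₗ mulOp (fun q : (X × ι) × Option J => χX q.1.1) =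
      ((LinearMap.id - mulOp (fun p : X × ι => ψX p.1)) ∘ₗ NV ∘ₗ mulOp (fun p : X × ι => χX p.1)) ∘ₗ projO none := by
  have h0 : (LinearMap.id - mulOp (fun p : X × ι => ψX p.1)) ∘ₗ mulOp (fun p : X × ι => χX p.1) = 0 := by
    rw [LinearMap.sub_comp, LinearMap.id_comp, hψχ, sub_self]
  rw [LinearMap.add_comp, LinearMap.comp_add, unstackM_comp_jetCut, ← LinearMap.comp_assoc, h0, LinearMap.zero_comp, zero_add]
  simp only [LinearMap.comp_assoc, projO_comp_jetCut]

end Structural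

/-! ## §2 The far-defect rows of a structural perturbation against the dressed smooth-cut cube, one grid and two grids -/

section Rows

variable {X X' ι J : Type} [Fintype X] [Fintype X'] [DecidableEq X] [DecidableEq X'] [Fintype ι] [DecidableEq ι] [Fintype J] [DecidableEq J] {g : B6.Geometry}
  (blk : X → g.Site) (π : X' → X) (τ : J → X ≃ X) (τ' : J → X' ≃ X') (n n' : ℝ) {σ cr : ℝ}
  {N : (X × ι → ℝ) →ₗ[ℝ] (X × ι → ℝ)} {N' : (X' × ι → ℝ) →ₗ[ℝ] (X' × ι → ℝ)} {V : ((X × ι) × Option (J ⊕ J) → ℝ) →ₗ[ℝ] (X × ι → ℝ)}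
  {V' : ((X' × ι) × Option (J ⊕ J) → ℝ) →ₗ[ℝ] (X' × ι → ℝ)} {NV : (X × ι → ℝ) →ₗ[ℝ] (X × ι → ℝ)} {NV' : (X' × ι → ℝ) →ₗ[ℝ] (X' × ι → ℝ)} {Cc : X → Matrix ι ι ℝ}
  {Ac : J ⊕ J → X → Matrix ι ι ℝ} {Cc' : X' → Matrix ι ι ℝ} {Ac' : J ⊕ J → X' → Matrix ι ι ℝ} {χX χtX ψX hX : X → ℝ} {χX' χtX' ψX' hX' : X' → ℝ} {S : Set g.Site}
  {β β₁ ct m₀ m₁ oχ o₁ o₂ δ : ℝ}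

omit [Fintype X] [Fintype X'] [DecidableEq X] [DecidableEq X'] [Fintype ι] [DecidableEq ι] [Fintype J] [DecidableEq J] in
/-- Transport of a row along an identity `A = −(T∘Z)` (no rewriting inside large operator terms). [folklore] -/
theorem hasMaj_of_eq_neg_comp {E : Type} [AddCommGroup E] [Module ℝ E] {b₁ : BlockNorm g E} {b₂ : BlockNorm g (X × ι → ℝ)} {A : E →ₗ[ℝ] (X × ι → ℝ)}
    {T : (X × ι → ℝ) →ₗ[ℝ] (X × ι → ℝ)} {Z : E →ₗ[ℝ] (X × ι → ℝ)} {K : g.Site → g.Site → ℝ} (hA : A = -(T ∘ₗ Z)) (h : HasMaj b₁ b₂ (T ∘ₗ Z) K) : HasMaj b₁ b₂ A K := by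
  subst hA
  exact h.neg

omit [Fintype X] [Fintype X'] [DecidableEq X] [DecidableEq X'] [Fintype ι] [DecidableEq ι] [Fintype J] [DecidableEq J] in
/-- THREE-FACTOR LEIBNIZ TRANSPORT: `A′ = −(T′M′Z′)`, `A = −(TMZ)` and a row of `T′(M′𝔇(Z′,Z) + 𝔇(M′,M)Z) + 𝔇(T′,T)(MZ)` give the row of `𝔇(A′, A)`. [folklore] -/
theorem hasMaj_idef_of_eq_neg_comp₃ (τ₀ : (X × ι → ℝ) →ₗ[ℝ] (X' × ι → ℝ)) {b₁ : BlockNorm g (X × ι → ℝ)} {b₂ : BlockNorm g (X' × ι → ℝ)} {A T M Z : (X × ι → ℝ) →ₗ[ℝ] (X × ι → ℝ)}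
    {A' T' M' Z' : (X' × ι → ℝ) →ₗ[ℝ] (X' × ι → ℝ)} {K : g.Site → g.Site → ℝ} (hA' : A' = -(T' ∘ₗ (M' ∘ₗ Z'))) (hA : A = -(T ∘ₗ (M ∘ₗ Z)))
    (h : HasMaj b₁ b₂ (T' ∘ₗ (M' ∘ₗ idef τ₀ τ₀ Z' Z + idef τ₀ τ₀ M' M ∘ₗ Z) + idef τ₀ τ₀ T' T ∘ₗ (M ∘ₗ Z)) K) :
    HasMaj b₁ b₂ (idef τ₀ τ₀ A' A) K := by
  subst hA'
  subst hA
  rw [TwoGrid.idef_neg_neg, idef_comp τ₀ τ₀ τ₀, idef_comp τ₀ τ₀ τ₀]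
  exact h.neg

omit [Fintype X] [Fintype X'] [DecidableEq X] [DecidableEq X'] [Fintype ι] [DecidableEq ι] [Fintype J] [DecidableEq J] in
/-- `𝔇(0, 0) = 0` transport: both operators vanish ⟹ any non-negative kernel majorises their defect. [folklore] -/
theorem hasMaj_idef_of_eq_zero (τ₀ : (X × ι → ℝ) →ₗ[ℝ] (X' × ι → ℝ)) {b₁ : BlockNorm g (X × ι → ℝ)} {b₂ : BlockNorm g (X' × ι → ℝ)} {A : (X × ι → ℝ) →ₗ[ℝ] (X × ι → ℝ)}
    {A' : (X' × ι → ℝ) →ₗ[ℝ] (X' × ι → ℝ)} {K : g.Site → g.Site → ℝ} (hA' : A' = 0) (hA : A = 0) (hK : ∀ y y', 0 ≤ K y y') : HasMaj b₁ b₂ (idef τ₀ τ₀ A' A) K := by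
  subst hA'
  subst hA
  rw [idef_zero]
  exact (hasMaj_zero _ _).mono hK

/-- ★ **THE FAR-DEFECT REMAINDER ROW OF A STRUCTURAL PERTURBATION, EXACTLY**: `[F, M_h]X = −((1 − M_ψ)N_VM_χ)∘(M_hX)` — the far part acts on the CUT propagator component only (file 49
`commOp_farDefect_comp_dressed_eq` + `farPart_structural` + `pr₀∘jet = 1`). [cite: Balaban1985BackgroundPropagators, (3.63)–(3.65) pp.402–403, (3.76)–(3.77) p.406 (mechanism)] -/
theorem commOp_farDefect_structural_eq {c : (X × ι) × Option (J ⊕ J) → ℝ} {h ψ : X × ι → ℝ} {G₀ : (X × ι → ℝ) →ₗ[ℝ] (X × ι → ℝ)} {D Dq : J ⊕ J → (X × ι → ℝ) →ₗ[ℝ] (X × ι → ℝ)}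
    (hD : ∀ j, D j = Dq j ∘ₗ G₀) (hunit : IsUnit (1 - LinearMap.toMatrix' (stack G₀ D ∘ₗ V))) (hC : mulOp c ∘ₗ stack G₀ D = stack G₀ D) (hhψ : mulOp h ∘ₗ mulOp ψ = mulOp h)
    (Vf : ((X × ι) × Option (J ⊕ J) → ℝ) →ₗ[ℝ] (X × ι → ℝ)) {T₁ : (X × ι → ℝ) →ₗ[ℝ] (X × ι → ℝ)} (hfar : (LinearMap.id - mulOp ψ) ∘ₗ Vf ∘ₗ mulOp c = T₁ ∘ₗ projO none)
    (hY : mulOp c ∘ₗ (stack LinearMap.id Dq ∘ₗ mulOp h ∘ₗ (projO none ∘ₗ bgPropV (stack G₀ D) V)) = stack LinearMap.id Dq ∘ₗ mulOp h ∘ₗ (projO none ∘ₗ bgPropV (stack G₀ D) V)) :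
    commOp (-((Vf - mulOp ψ ∘ₗ Vf ∘ₗ mulOp c) ∘ₗ stack LinearMap.id Dq)) h ∘ₗ (projO none ∘ₗ bgPropV (stack G₀ D) V) =
      -(T₁ ∘ₗ (mulOp h ∘ₗ (projO none ∘ₗ bgPropV (stack G₀ D) V))) := by
  rw [commOp_farDefect_comp_dressed_eq hD hunit hC hhψ Vf hY, hfar]
  simp only [LinearMap.comp_assoc]
  rw [← LinearMap.comp_assoc (mulOp h ∘ₗ (projO none ∘ₗ bgPropV (stack G₀ D) V)) (stack LinearMap.id Dq) (projO none), projO_none_comp_stack, LinearMap.id_comp]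

/-- ★★ **ONE GRID, STRUCTURAL PERTURBATION**: `[F, M_h]X ≤ 1_S(y′)·(θ_F·B̄′·c_r)e^{−ρ₃d}` from the far letter of the NONLOCAL summand alone, `(1 − M_ψ)N_VM_χ ≤ θ_Fe^{−ρ_Fd}` (`ρ₃ + σ ≤ ρ_F`) — no
derivative letter of the partition needed (file 49's general row at the better constant). [cite: Balaban1985BackgroundPropagators, (3.34)–(3.35) p.396, (3.63)–(3.65) pp.402–403, (3.76)–(3.77) p.406 (mechanism)] -/
theorem hasMaj_commOp_farDefect_structural
    (htri : Triangle254 g) (hd : ∀ a b : g.Site, 0 ≤ g.dist a b) (hrow : RowSum g σ cr) (hσ : 0 ≤ σ) {ρ₁ ρ₂ δV R : ℝ} (hβ : 0 ≤ β) (hβ₁ : 0 ≤ β₁)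
    (hct : 0 ≤ ct) (hR : 0 ≤ R) (hcr : 0 ≤ cr) (hσρ : σ ≤ ρ₁) (hρ₁V : ρ₁ ≤ δV) (hρ₁G : ρ₁ + σ ≤ δ) (hρ₂ : 0 ≤ ρ₂) (hρ₂₁ : ρ₂ + σ ≤ ρ₁)
    (hSχ : ∀ x, χX x ≠ 0 → blk x ∈ S) (hSψ : ∀ x, ψX x ≠ 0 → blk x ∈ S) (hχt : ∀ x, |χtX x| ≤ 1)
    (hdχt : ∀ μ p, |fgrad n (liftEquiv (τ μ) ι) (fun p : X × ι => χtX p.1) p| ≤ ct) (hdχtb : ∀ μ p, |bgrad n (liftEquiv (τ μ) ι) (fun p : X × ι => χtX p.1) p| ≤ ct)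
    (hsub : mulOp (fun p : X × ι => χtX p.1) ∘ₗ mulOp (fun p : X × ι => χX p.1) = mulOp (fun p : X × ι => χtX p.1))
    (hχ : mulOp (fun p : X × ι => χX p.1) ∘ₗ mulOp (fun p : X × ι => χtX p.1) = mulOp (fun p : X × ι => χtX p.1))
    (hs : ∀ μ, mulOp ((fun p : X × ι => χtX p.1) ∘ (liftEquiv (τ μ) ι)) ∘ₗ mulOp (fun p : X × ι => χX p.1) = mulOp ((fun p : X × ι => χtX p.1) ∘ (liftEquiv (τ μ) ι)))
    (hsb : ∀ μ, mulOp ((fun p : X × ι => χtX p.1) ∘ (liftEquiv (τ μ) ι).symm) ∘ₗ mulOp (fun p : X × ι => χX p.1) = mulOp ((fun p : X × ι => χtX p.1) ∘ (liftEquiv (τ μ) ι).symm))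
    (hdd : ∀ μ, mulOp (fgrad n (liftEquiv (τ μ) ι) (fun p : X × ι => χtX p.1)) ∘ₗ mulOp (fun p : X × ι => χX p.1) = mulOp (fgrad n (liftEquiv (τ μ) ι) (fun p : X × ι => χtX p.1)))
    (hddb : ∀ μ, mulOp (bgrad n (liftEquiv (τ μ) ι) (fun p : X × ι => χtX p.1)) ∘ₗ mulOp (fun p : X × ι => χX p.1) = mulOp (bgrad n (liftEquiv (τ μ) ι) (fun p : X × ι => χtX p.1)))
    (hs2 : ∀ μ, mulOp (fun p : X × ι => χX p.1) ∘ₗ mulOp ((fun p : X × ι => χtX p.1) ∘ (liftEquiv (τ μ) ι)) = mulOp ((fun p : X × ι => χtX p.1) ∘ (liftEquiv (τ μ) ι)))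
    (hsb2 : ∀ μ, mulOp (fun p : X × ι => χX p.1) ∘ₗ mulOp ((fun p : X × ι => χtX p.1) ∘ (liftEquiv (τ μ) ι).symm) = mulOp ((fun p : X × ι => χtX p.1) ∘ (liftEquiv (τ μ) ι).symm))
    (hdd2 : ∀ μ, mulOp (fun p : X × ι => χX p.1) ∘ₗ mulOp (fgrad n (liftEquiv (τ μ) ι) (fun p : X × ι => χtX p.1)) = mulOp (fgrad n (liftEquiv (τ μ) ι) (fun p : X × ι => χtX p.1)))
    (hddb2 : ∀ μ, mulOp (fun p : X × ι => χX p.1) ∘ₗ mulOp (bgrad n (liftEquiv (τ μ) ι) (fun p : X × ι => χtX p.1)) = mulOp (bgrad n (liftEquiv (τ μ) ι) (fun p : X × ι => χtX p.1)))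
    (hNψ : N ∘ₗ mulOp (fun p : X × ι => ψX p.1) = N)
    (hcut : HasMaj (BlockNorm.ofBlocks g (liftBlk blk ι)) (BlockNorm.ofBlocks g (liftBlk blk ι)) (mulOp (fun p : X × ι => χX p.1) ∘ₗ N) (fun y y' => ind S y * ind S y' * (β * Real.exp (-(δ * g.dist y y')))))
    (hcutF : ∀ μ, HasMaj (BlockNorm.ofBlocks g (liftBlk blk ι)) (BlockNorm.ofBlocks g (liftBlk blk ι)) (mulOp (fun p : X × ι => χX p.1) ∘ₗ (fgrad n (liftEquiv (τ μ) ι) ∘ₗ N)) (fun y y' => ind S y * ind S y' * (β₁ * Real.exp (-(δ * g.dist y y')))))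
    (hcutB : ∀ μ, HasMaj (BlockNorm.ofBlocks g (liftBlk blk ι)) (BlockNorm.ofBlocks g (liftBlk blk ι)) (mulOp (fun p : X × ι => χX p.1) ∘ₗ (bgrad n (liftEquiv (τ μ) ι) ∘ₗ N)) (fun y y' => ind S y * ind S y' * (β₁ * Real.exp (-(δ * g.dist y y')))))
    (hV : HasMaj (BlockNorm.ofBlocks g (blkPair (liftBlk blk ι))) (BlockNorm.ofBlocks g (liftBlk blk ι)) V (fun y y' => R * Real.exp (-(δV * g.dist y y'))))
    (hq : (β + (β₁ + ct * β)) * (R * cr) * cr < 1)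
    {θF ρ₃ ρF : ℝ} (hθF : 0 ≤ θF) (hρ₃ : 0 ≤ ρ₃) (hρ₃₂ : ρ₃ ≤ ρ₂) (hρF : ρ₃ + σ ≤ ρF)
    (hhabs : ∀ x, |hX x| ≤ 1) (hhψ : mulOp (fun p : X × ι => hX p.1) ∘ₗ mulOp (fun p : X × ι => ψX p.1) = mulOp (fun p : X × ι => hX p.1)) (hχh : mulOp (fun p : X × ι => χX p.1) ∘ₗ mulOp (fun p : X × ι => hX p.1) = mulOp (fun p : X × ι => hX p.1))
    (hhs' : ∀ μ, mulOp (fun p : X × ι => χX p.1) ∘ₗ mulOp ((fun p : X × ι => hX p.1) ∘ (liftEquiv (τ μ) ι)) = mulOp ((fun p : X × ι => hX p.1) ∘ (liftEquiv (τ μ) ι)))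
    (hhsb' : ∀ μ, mulOp (fun p : X × ι => χX p.1) ∘ₗ mulOp ((fun p : X × ι => hX p.1) ∘ (liftEquiv (τ μ) ι).symm) = mulOp ((fun p : X × ι => hX p.1) ∘ (liftEquiv (τ μ) ι).symm))
    (hhdd' : ∀ μ, mulOp (fun p : X × ι => χX p.1) ∘ₗ mulOp (fgrad n (liftEquiv (τ μ) ι) (fun p : X × ι => hX p.1)) = mulOp (fgrad n (liftEquiv (τ μ) ι) (fun p : X × ι => hX p.1)))
    (hhddb' : ∀ μ, mulOp (fun p : X × ι => χX p.1) ∘ₗ mulOp (bgrad n (liftEquiv (τ μ) ι) (fun p : X × ι => hX p.1)) = mulOp (bgrad n (liftEquiv (τ μ) ι) (fun p : X × ι => hX p.1)))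
    (hψχ : mulOp (fun p : X × ι => ψX p.1) ∘ₗ mulOp (fun p : X × ι => χX p.1) = mulOp (fun p : X × ι => χX p.1))
    (hfarN : HasMaj (BlockNorm.ofBlocks g (liftBlk blk ι)) (BlockNorm.ofBlocks g (liftBlk blk ι)) ((LinearMap.id - mulOp (fun p : X × ι => ψX p.1)) ∘ₗ NV ∘ₗ mulOp (fun p : X × ι => χX p.1)) (fun y y' => θF * Real.exp (-(ρF * g.dist y y')))) :
    HasMaj (BlockNorm.ofBlocks g (liftBlk blk ι)) (BlockNorm.ofBlocks g (liftBlk blk ι)) (commOp (-(((unstackM Cc Ac + NV ∘ₗ projO none) - mulOp (fun p : X × ι => ψX p.1) ∘ₗ (unstackM Cc Ac + NV ∘ₗ projO none) ∘ₗ mulOp (fun q : (X × ι) × Option (J ⊕ J) => χX q.1.1)) ∘ₗ stack LinearMap.id (fun j => Sum.elim (fun μ => fgrad n (liftEquiv (τ μ) ι)) (fun μ => bgrad n (liftEquiv (τ μ) ι)) j))) (fun p : X × ι => hX p.1) ∘ₗ (projO none ∘ₗ bgPropV (stack (mulOp (fun p : X × ι => χtX p.1) ∘ₗ N) (fun j =>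 Sum.elim (fun μ => fgrad n (liftEquiv (τ μ) ι)) (fun μ => bgrad n (liftEquiv (τ μ) ι)) j ∘ₗ (mulOp (fun p : X × ι => χtX p.1) ∘ₗ N))) V))
      (fun y y' => ind S y' * (θF * (1 * ((β + (β₁ + ct * β)) * (1 - (β + (β₁ + ct * β)) * (R * cr) * cr)⁻¹)) * cr * Real.exp (-(ρ₃ * g.dist y y')))) := by
  have hβb : 0 ≤ β + (β₁ + ct * β) := by positivity
  have hqi : 0 ≤ (1 - (β + (β₁ + ct * β)) * (R * cr) * cr)⁻¹ := inv_nonneg.2 (by linarith)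
  have hB : 0 ≤ ((β + (β₁ + ct * β)) * (1 - (β + (β₁ + ct * β)) * (R * cr) * cr)⁻¹) := mul_nonneg hβb hqi
  have hG := hasMaj_smoothCut_flat blk (S := S) hβ hβ₁ hct hχt hsub hcut
  have hD := hasMaj_jet_smoothCut_flat blk τ n (S := S) hβ hβ₁ hct hχt hdχt hdχtb hs hsb hdd hddb hcut hcutF hcutB
  have hunit := (hasMaj_dressedV_pair blk htri hd hrow hσ hβb hR hcr hσρ hρ₁V hρ₁G hρ₂ hρ₂₁ hG hD hV hq).1
  have hS := jetCut_comp_jet_mulOp_comp τ n hχ hs2 hsb2 hdd2 hddb2 N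
  rw [jet_comp_eq_stack] at hS
  have hYloc := jetCut_comp_jet_mulOp_comp τ n hχh hhs' hhsb' hhdd' hhddb' (projO none ∘ₗ bgPropV (stack (mulOp (fun p : X × ι => χtX p.1) ∘ₗ N) (fun j => Sum.elim (fun μ => fgrad n (liftEquiv (τ μ) ι)) (fun μ => bgrad n (liftEquiv (τ μ) ι)) j ∘ₗ (mulOp (fun p : X × ι => χtX p.1) ∘ₗ N))) V)
  have hX0 := hasMaj_smoothCutDressed_loc₂ blk τ n htri hd hrow hσ hβ hβ₁ hct hR hcr hσρ hρ₁V hρ₁G hρ₂ hρ₂₁ hSχ hSψ hχt hdχt hdχtb hsub hχ hs hsb hdd hddb hNψ hcut hcutF hcutB hV hq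
  have hMh : HasMaj (BlockNorm.ofBlocks g (liftBlk blk ι)) (BlockNorm.ofBlocks g (liftBlk blk ι)) (mulOp (fun p : X × ι => hX p.1)) (diagK fun _ => (1 : ℝ)) := hasMaj_mulOp (liftBlk blk ι) (fun _ => zero_le_one) fun p => hhabs p.1
  have hY := (hasMaj_diag_comp (liftBlk blk ι) (fun _ => zero_le_one) hMh hX0).mono fun y y' =>
    (le_of_eq (by ring) : _ ≤ ind S y * ind S y' * ((1 * ((β + (β₁ + ct * β)) * (1 - (β + (β₁ + ct * β)) * (R * cr) * cr)⁻¹)) * Real.exp (-(ρ₂ * g.dist y y'))))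
  exact hasMaj_of_eq_neg_comp (commOp_farDefect_structural_eq (fun _ => rfl) hunit hS hhψ (unstackM Cc Ac + NV ∘ₗ projO none) (farPart_structural Cc Ac NV χX ψX hψχ) hYloc)
    (hasMaj_comp_exp_in (liftBlk blk ι) htri hd hrow hθF (mul_nonneg zero_le_one hB) hρ₃ hρ₃₂ hρF hfarN hY)

/-- ★★★ **TWO GRIDS, STRUCTURAL PERTURBATIONS**: the η-defect of the far-defect remainder rows (file 48's `hDFK`): with file 35's data for both grids' dressed smooth-cut cubes, the
partitions' letters∕fit∕supports, the fine far letter `θ_F` and the two-grid defect `r_F` of the far parts `(1 − M_ψ)N_VM_χ` (rate `ρ_F ≥ ρ₃ + σ`):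
`𝔇([F′, M_{h′}]X′, [F, M_h]X) ≤ 1_S(y′)·((θ_F(A_D + o·B̄′) + r_F·B̄′)c_r)e^{−ρ₃d}` with file 35's `A_D` and file 34's `B̄′` (three-factor Leibniz: `𝔇(T′₁M_{h′}X′, T₁M_hX) = T′₁(M_{h′}𝔇(X′,X) +
𝔇(M_{h′},M_h)X) + 𝔇(T′₁,T₁)M_hX`). [cite: Balaban1985BackgroundPropagators, Thm 3.14 pp.426–427 (template), (3.34)–(3.35) p.396, (3.63)–(3.65) pp.402–403, (3.76)–(3.77) p.406 (mechanism)] -/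
theorem hasMaj_idef_commOp_farDefect_structural (htri : Triangle254 g) (hd : ∀ a b : g.Site, 0 ≤ g.dist a b) (hrow : RowSum g σ cr) (hσ : 0 ≤ σ) (hcr : 0 ≤ cr) {ρ₁ ρ₂ δV R o : ℝ}
    (hβ : 0 ≤ β) (hβ₁ : 0 ≤ β₁) (hct : 0 ≤ ct) (hm₀ : 0 ≤ m₀) (hm₁ : 0 ≤ m₁) (hoχ : 0 ≤ oχ) (ho₁ : 0 ≤ o₁) (ho₂ : 0 ≤ o₂) (hR : 0 ≤ R) (ho : 0 ≤ o) (hσρ : σ ≤ ρ₁)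
    (hρ₁V : ρ₁ ≤ δV) (hρ₁G : ρ₁ + σ ≤ δ) (hρ₂ : 0 ≤ ρ₂) (hρ₂₁ : ρ₂ + σ ≤ ρ₁)
    -- supports of the cuts over `S`, both grids
    (hSχ : ∀ x, χX x ≠ 0 → blk x ∈ S) (hSψ : ∀ x, ψX x ≠ 0 → blk x ∈ S) (hSχ' : ∀ x', χX' x' ≠ 0 → blk (π x') ∈ S) (hSψ' : ∀ x', ψX' x' ≠ 0 → blk (π x') ∈ S)
    -- coarse bump data
    (hχt : ∀ x, |χtX x| ≤ 1)
    (hdχt : ∀ μ p, |fgrad n (liftEquiv (τ μ) ι) (fun p : X × ι => χtX p.1) p| ≤ ct) (hdχtb : ∀ μ p, |bgrad n (liftEquiv (τ μ) ι) (fun p : X × ι => χtX p.1) p| ≤ ct)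
    (hsub : mulOp (fun p : X × ι => χtX p.1) ∘ₗ mulOp (fun p : X × ι => χX p.1) = mulOp (fun p : X × ι => χtX p.1))
    (hχ : mulOp (fun p : X × ι => χX p.1) ∘ₗ mulOp (fun p : X × ι => χtX p.1) = mulOp (fun p : X × ι => χtX p.1))
    (hs : ∀ μ, mulOp ((fun p : X × ι => χtX p.1) ∘ (liftEquiv (τ μ) ι)) ∘ₗ mulOp (fun p : X × ι => χX p.1) = mulOp ((fun p : X × ι => χtX p.1) ∘ (liftEquiv (τ μ) ι)))
    (hsb : ∀ μ, mulOp ((fun p : X × ι => χtX p.1) ∘ (liftEquiv (τ μ) ι).symm) ∘ₗ mulOp (fun p : X × ι => χX p.1) = mulOp ((fun p : X × ι => χtX p.1) ∘ (liftEquiv (τ μ) ι).symm))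
    (hdd : ∀ μ, mulOp (fgrad n (liftEquiv (τ μ) ι) (fun p : X × ι => χtX p.1)) ∘ₗ mulOp (fun p : X × ι => χX p.1) = mulOp (fgrad n (liftEquiv (τ μ) ι) (fun p : X × ι => χtX p.1)))
    (hddb : ∀ μ, mulOp (bgrad n (liftEquiv (τ μ) ι) (fun p : X × ι => χtX p.1)) ∘ₗ mulOp (fun p : X × ι => χX p.1) = mulOp (bgrad n (liftEquiv (τ μ) ι) (fun p : X × ι => χtX p.1)))
    (hNψ : N ∘ₗ mulOp (fun p : X × ι => ψX p.1) = N)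
    -- fine bump data
    (hχt' : ∀ x', |χtX' x'| ≤ 1)
    (hdχt' : ∀ μ p', |fgrad n' (liftEquiv (τ' μ) ι) (fun p' : X' × ι => χtX' p'.1) p'| ≤ ct) (hdχtb' : ∀ μ p', |bgrad n' (liftEquiv (τ' μ) ι) (fun p' : X' × ι => χtX' p'.1) p'| ≤ ct)
    (hsub' : mulOp (fun p : X' × ι => χtX' p.1) ∘ₗ mulOp (fun p : X' × ι => χX' p.1) = mulOp (fun p : X' × ι => χtX' p.1))
    (hχ' : mulOp (fun p : X' × ι => χX' p.1) ∘ₗ mulOp (fun p : X' × ι => χtX' p.1) = mulOp (fun p : X' × ι => χtX' p.1))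
    (hs' : ∀ μ, mulOp ((fun p' : X' × ι => χtX' p'.1) ∘ (liftEquiv (τ' μ) ι)) ∘ₗ mulOp (fun p' : X' × ι => χX' p'.1) = mulOp ((fun p' : X' × ι => χtX' p'.1) ∘ (liftEquiv (τ' μ) ι)))
    (hsb' : ∀ μ, mulOp ((fun p' : X' × ι => χtX' p'.1) ∘ (liftEquiv (τ' μ) ι).symm) ∘ₗ mulOp (fun p' : X' × ι => χX' p'.1) =
      mulOp ((fun p' : X' × ι => χtX' p'.1) ∘ (liftEquiv (τ' μ) ι).symm))
    (hdd' : ∀ μ, mulOp (fgrad n' (liftEquiv (τ' μ) ι) (fun p' : X' × ι => χtX' p'.1)) ∘ₗ mulOp (fun p' : X' × ι => χX' p'.1) = mulOp (fgrad n' (liftEquiv (τ' μ) ι) (fun p' : X' × ι => χtX' p'.1)))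
    (hddb' : ∀ μ, mulOp (bgrad n' (liftEquiv (τ' μ) ι) (fun p' : X' × ι => χtX' p'.1)) ∘ₗ mulOp (fun p' : X' × ι => χX' p'.1) = mulOp (bgrad n' (liftEquiv (τ' μ) ι) (fun p' : X' × ι => χtX' p'.1)))
    (hNψ' : N' ∘ₗ mulOp (fun p : X' × ι => ψX' p.1) = N')
    -- fits of the bumps across `π`
    (hfitχ : ∀ x', |χtX' x' - χtX (π x')| ≤ oχ)
    (hfit₁ : ∀ μ p', |((fun p' : X' × ι => χtX' p'.1) ∘ (liftEquiv (τ' μ) ι)) p' - ((fun p : X × ι => χtX p.1) ∘ (liftEquiv (τ μ) ι)) (liftMap π ι p')| ≤ o₁)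
    (hfit₁b : ∀ μ p', |((fun p' : X' × ι => χtX' p'.1) ∘ (liftEquiv (τ' μ) ι).symm) p' - ((fun p : X × ι => χtX p.1) ∘ (liftEquiv (τ μ) ι).symm) (liftMap π ι p')| ≤ o₁)
    (hfit₂ : ∀ μ p', |fgrad n' (liftEquiv (τ' μ) ι) (fun p' : X' × ι => χtX' p'.1) p' - fgrad n (liftEquiv (τ μ) ι) (fun p : X × ι => χtX p.1) (liftMap π ι p')| ≤ o₂)
    (hfit₂b : ∀ μ p', |bgrad n' (liftEquiv (τ' μ) ι) (fun p' : X' × ι => χtX' p'.1) p' - bgrad n (liftEquiv (τ μ) ι) (fun p : X × ι => χtX p.1) (liftMap π ι p')| ≤ o₂)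
    -- cut rows and their defects
    (hcut : HasMaj (BlockNorm.ofBlocks g (liftBlk blk ι)) (BlockNorm.ofBlocks g (liftBlk blk ι)) (mulOp (fun p : X × ι => χX p.1) ∘ₗ N)
      (fun y y' => ind S y * ind S y' * (β * Real.exp (-(δ * g.dist y y')))))
    (hcutF : ∀ μ, HasMaj (BlockNorm.ofBlocks g (liftBlk blk ι)) (BlockNorm.ofBlocks g (liftBlk blk ι)) (mulOp (fun p : X × ι => χX p.1) ∘ₗ (fgrad n (liftEquiv (τ μ) ι) ∘ₗ N))
      (fun y y' => ind S y * ind S y' * (β₁ * Real.exp (-(δ * g.dist y y')))))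
    (hcutB : ∀ μ, HasMaj (BlockNorm.ofBlocks g (liftBlk blk ι)) (BlockNorm.ofBlocks g (liftBlk blk ι)) (mulOp (fun p : X × ι => χX p.1) ∘ₗ (bgrad n (liftEquiv (τ μ) ι) ∘ₗ N))
      (fun y y' => ind S y * ind S y' * (β₁ * Real.exp (-(δ * g.dist y y')))))
    (hcut' : HasMaj (BlockNorm.ofBlocks g (liftBlk (blk ∘ π) ι)) (BlockNorm.ofBlocks g (liftBlk (blk ∘ π) ι)) (mulOp (fun p : X' × ι => χX' p.1) ∘ₗ N')
      (fun y y' => ind S y * ind S y' * (β * Real.exp (-(δ * g.dist y y')))))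
    (hcutF' : ∀ μ, HasMaj (BlockNorm.ofBlocks g (liftBlk (blk ∘ π) ι)) (BlockNorm.ofBlocks g (liftBlk (blk ∘ π) ι)) (mulOp (fun p : X' × ι => χX' p.1) ∘ₗ (fgrad n' (liftEquiv (τ' μ) ι) ∘ₗ N'))
      (fun y y' => ind S y * ind S y' * (β₁ * Real.exp (-(δ * g.dist y y')))))
    (hcutB' : ∀ μ, HasMaj (BlockNorm.ofBlocks g (liftBlk (blk ∘ π) ι)) (BlockNorm.ofBlocks g (liftBlk (blk ∘ π) ι)) (mulOp (fun p : X' × ι => χX' p.1) ∘ₗ (bgrad n' (liftEquiv (τ' μ) ι) ∘ₗ N'))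
      (fun y y' => ind S y * ind S y' * (β₁ * Real.exp (-(δ * g.dist y y')))))
    (hDcut : HasMaj (BlockNorm.ofBlocks g (liftBlk blk ι)) (BlockNorm.ofBlocks g (liftBlk blk ι ∘ liftMap π ι))
      (idef (pull (liftMap π ι)) (pull (liftMap π ι)) (mulOp (fun p : X' × ι => χX' p.1) ∘ₗ N') (mulOp (fun p : X × ι => χX p.1) ∘ₗ N))
      (fun y y' => ind S y * ind S y' * (m₀ * Real.exp (-(δ * g.dist y y')))))
    (hDcutF : ∀ μ, HasMaj (BlockNorm.ofBlocks g (liftBlk blk ι)) (BlockNorm.ofBlocks g (liftBlk blk ι ∘ liftMap π ι))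
      (idef (pull (liftMap π ι)) (pull (liftMap π ι)) (mulOp (fun p : X' × ι => χX' p.1) ∘ₗ (fgrad n' (liftEquiv (τ' μ) ι) ∘ₗ N')) (mulOp (fun p : X × ι => χX p.1) ∘ₗ (fgrad n (liftEquiv (τ μ) ι) ∘ₗ N)))
      (fun y y' => ind S y * ind S y' * (m₁ * Real.exp (-(δ * g.dist y y')))))
    (hDcutB : ∀ μ, HasMaj (BlockNorm.ofBlocks g (liftBlk blk ι)) (BlockNorm.ofBlocks g (liftBlk blk ι ∘ liftMap π ι))
      (idef (pull (liftMap π ι)) (pull (liftMap π ι)) (mulOp (fun p : X' × ι => χX' p.1) ∘ₗ (bgrad n' (liftEquiv (τ' μ) ι) ∘ₗ N')) (mulOp (fun p : X × ι => χX p.1) ∘ₗ (bgrad n (liftEquiv (τ μ) ι) ∘ₗ N)))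
      (fun y y' => ind S y * ind S y' * (m₁ * Real.exp (-(δ * g.dist y y')))))
    -- the perturbation at both grids
    (hV : HasMaj (BlockNorm.ofBlocks g (blkPair (liftBlk blk ι))) (BlockNorm.ofBlocks g (liftBlk blk ι)) V (fun y y' => R * Real.exp (-(δV * g.dist y y'))))
    (hV' : HasMaj (BlockNorm.ofBlocks g (blkPair (liftBlk (blk ∘ π) ι))) (BlockNorm.ofBlocks g (liftBlk (blk ∘ π) ι)) V' (fun y y' => R * Real.exp (-(δV * g.dist y y'))))
    (hDV : HasMaj (BlockNorm.ofBlocks g (blkPair (liftBlk blk ι))) (BlockNorm.ofBlocks g (liftBlk (blk ∘ π) ι))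
      (idef (pull (liftPair (liftMap π ι))) (pull (liftMap π ι)) V' V) (fun y y' => o * Real.exp (-(δV * g.dist y y'))))
    -- reversed insertions (output cut-offs of the shifted bumps), both grids
    (hs2 : ∀ μ, mulOp (fun p : X × ι => χX p.1) ∘ₗ mulOp ((fun p : X × ι => χtX p.1) ∘ (liftEquiv (τ μ) ι)) = mulOp ((fun p : X × ι => χtX p.1) ∘ (liftEquiv (τ μ) ι)))
    (hsb2 : ∀ μ, mulOp (fun p : X × ι => χX p.1) ∘ₗ mulOp ((fun p : X × ι => χtX p.1) ∘ (liftEquiv (τ μ) ι).symm) = mulOp ((fun p : X × ι => χtX p.1) ∘ (liftEquiv (τ μ) ι).symm))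
    (hdd2 : ∀ μ, mulOp (fun p : X × ι => χX p.1) ∘ₗ mulOp (fgrad n (liftEquiv (τ μ) ι) (fun p : X × ι => χtX p.1)) = mulOp (fgrad n (liftEquiv (τ μ) ι) (fun p : X × ι => χtX p.1)))
    (hddb2 : ∀ μ, mulOp (fun p : X × ι => χX p.1) ∘ₗ mulOp (bgrad n (liftEquiv (τ μ) ι) (fun p : X × ι => χtX p.1)) = mulOp (bgrad n (liftEquiv (τ μ) ι) (fun p : X × ι => χtX p.1)))
    (hs2' : ∀ μ, mulOp (fun p : X' × ι => χX' p.1) ∘ₗ mulOp ((fun p : X' × ι => χtX' p.1) ∘ (liftEquiv (τ' μ) ι)) = mulOp ((fun p : X' × ι => χtX' p.1) ∘ (liftEquiv (τ' μ) ι)))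
    (hsb2' : ∀ μ, mulOp (fun p : X' × ι => χX' p.1) ∘ₗ mulOp ((fun p : X' × ι => χtX' p.1) ∘ (liftEquiv (τ' μ) ι).symm) = mulOp ((fun p : X' × ι => χtX' p.1) ∘ (liftEquiv (τ' μ) ι).symm))
    (hdd2' : ∀ μ, mulOp (fun p : X' × ι => χX' p.1) ∘ₗ mulOp (fgrad n' (liftEquiv (τ' μ) ι) (fun p : X' × ι => χtX' p.1)) = mulOp (fgrad n' (liftEquiv (τ' μ) ι) (fun p : X' × ι => χtX' p.1)))
    (hddb2' : ∀ μ, mulOp (fun p : X' × ι => χX' p.1) ∘ₗ mulOp (bgrad n' (liftEquiv (τ' μ) ι) (fun p : X' × ι => χtX' p.1)) = mulOp (bgrad n' (liftEquiv (τ' μ) ι) (fun p : X' × ι => χtX' p.1)))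
    -- the partitions: sizes, fit across `π`, supports inside `ψ` and `χ` (with shifts and differences), both grids; `ψχ = χ` both grids
    {oo : ℝ} (hhabs : ∀ x, |hX x| ≤ 1) (hhabs' : ∀ x', |hX' x'| ≤ 1) (hfh : ∀ p' : X' × ι, |hX' p'.1 - hX (π p'.1)| ≤ oo) (hoo : 0 ≤ oo)
    (hhψ : mulOp (fun p : X × ι => hX p.1) ∘ₗ mulOp (fun p : X × ι => ψX p.1) = mulOp (fun p : X × ι => hX p.1)) (hχh : mulOp (fun p : X × ι => χX p.1) ∘ₗ mulOp (fun p : X × ι => hX p.1) = mulOp (fun p : X × ι => hX p.1))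
    (hhs' : ∀ μ, mulOp (fun p : X × ι => χX p.1) ∘ₗ mulOp ((fun p : X × ι => hX p.1) ∘ (liftEquiv (τ μ) ι)) = mulOp ((fun p : X × ι => hX p.1) ∘ (liftEquiv (τ μ) ι)))
    (hhsb' : ∀ μ, mulOp (fun p : X × ι => χX p.1) ∘ₗ mulOp ((fun p : X × ι => hX p.1) ∘ (liftEquiv (τ μ) ι).symm) = mulOp ((fun p : X × ι => hX p.1) ∘ (liftEquiv (τ μ) ι).symm))
    (hhdd' : ∀ μ, mulOp (fun p : X × ι => χX p.1) ∘ₗ mulOp (fgrad n (liftEquiv (τ μ) ι) (fun p : X × ι => hX p.1)) = mulOp (fgrad n (liftEquiv (τ μ) ι) (fun p : X × ι => hX p.1)))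
    (hhddb' : ∀ μ, mulOp (fun p : X × ι => χX p.1) ∘ₗ mulOp (bgrad n (liftEquiv (τ μ) ι) (fun p : X × ι => hX p.1)) = mulOp (bgrad n (liftEquiv (τ μ) ι) (fun p : X × ι => hX p.1)))
    (hψχ : mulOp (fun p : X × ι => ψX p.1) ∘ₗ mulOp (fun p : X × ι => χX p.1) = mulOp (fun p : X × ι => χX p.1))
    (hhψf : mulOp (fun p : X' × ι => hX' p.1) ∘ₗ mulOp (fun p : X' × ι => ψX' p.1) = mulOp (fun p : X' × ι => hX' p.1)) (hχhf : mulOp (fun p : X' × ι => χX' p.1) ∘ₗ mulOp (fun p : X' × ι => hX' p.1) = mulOp (fun p : X' × ι => hX' p.1))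
    (hhsf : ∀ μ, mulOp (fun p : X' × ι => χX' p.1) ∘ₗ mulOp ((fun p : X' × ι => hX' p.1) ∘ (liftEquiv (τ' μ) ι)) = mulOp ((fun p : X' × ι => hX' p.1) ∘ (liftEquiv (τ' μ) ι)))
    (hhsbf : ∀ μ, mulOp (fun p : X' × ι => χX' p.1) ∘ₗ mulOp ((fun p : X' × ι => hX' p.1) ∘ (liftEquiv (τ' μ) ι).symm) = mulOp ((fun p : X' × ι => hX' p.1) ∘ (liftEquiv (τ' μ) ι).symm))
    (hhddf : ∀ μ, mulOp (fun p : X' × ι => χX' p.1) ∘ₗ mulOp (fgrad n' (liftEquiv (τ' μ) ι) (fun p : X' × ι => hX' p.1)) = mulOp (fgrad n' (liftEquiv (τ' μ) ι) (fun p : X' × ι => hX' p.1)))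
    (hhddbf : ∀ μ, mulOp (fun p : X' × ι => χX' p.1) ∘ₗ mulOp (bgrad n' (liftEquiv (τ' μ) ι) (fun p : X' × ι => hX' p.1)) = mulOp (bgrad n' (liftEquiv (τ' μ) ι) (fun p : X' × ι => hX' p.1)))
    (hψχf : mulOp (fun p : X' × ι => ψX' p.1) ∘ₗ mulOp (fun p : X' × ι => χX' p.1) = mulOp (fun p : X' × ι => χX' p.1))
    -- the far letters: the fine nonlocal far part and the two-grid defect of the far parts; rates
    {θF rF ρ₃ ρF : ℝ} (hθF : 0 ≤ θF) (hrF : 0 ≤ rF) (hρ₃ : 0 ≤ ρ₃) (hρ₃₂ : ρ₃ ≤ ρ₂) (hρF : ρ₃ + σ ≤ ρF)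
    (hfarN' : HasMaj (BlockNorm.ofBlocks g (liftBlk (blk ∘ π) ι)) (BlockNorm.ofBlocks g (liftBlk (blk ∘ π) ι)) ((LinearMap.id - mulOp (fun p : X' × ι => ψX' p.1)) ∘ₗ NV' ∘ₗ mulOp (fun p : X' × ι => χX' p.1)) (fun y y' => θF * Real.exp (-(ρF * g.dist y y'))))
    (hDfarN : HasMaj (BlockNorm.ofBlocks g (liftBlk blk ι)) (BlockNorm.ofBlocks g (liftBlk (blk ∘ π) ι)) (idef (pull (liftMap π ι)) (pull (liftMap π ι)) ((LinearMap.id - mulOp (fun p : X' × ι => ψX' p.1)) ∘ₗ NV' ∘ₗ mulOp (fun p : X' × ι => χX' p.1)) ((LinearMap.id - mulOp (fun p : X × ι => ψX p.1)) ∘ₗ NV ∘ₗ mulOp (fun p : X × ι => χX p.1))) (fun y y' => rF * Real.exp (-(ρF * g.dist y y'))))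
    (hq : (β + (β₁ + ct * β)) * (R * cr) * cr < 1) :
    HasMaj (BlockNorm.ofBlocks g (liftBlk blk ι)) (BlockNorm.ofBlocks g (liftBlk (blk ∘ π) ι))
      (idef (pull (liftMap π ι)) (pull (liftMap π ι)) (commOp (-(((unstackM Cc' Ac' + NV' ∘ₗ projO none) - mulOp (fun p : X' × ι => ψX' p.1) ∘ₗ (unstackM Cc' Ac' + NV' ∘ₗ projO none) ∘ₗ mulOp (fun q : (X' × ι) × Option (J ⊕ J) => χX' q.1.1)) ∘ₗ stack LinearMap.id (fun j => Sum.elim (fun μ => fgrad n' (liftEquiv (τ' μ) ι)) (fun μ => bgrad n' (liftEquiv (τ' μ) ι)) j))) (fun p : X' × ι => hX' p.1) ∘ₗ (projO none ∘ₗ bgPropV (stack (mulOp (fun p : X' × ι => χtX' p.1) ∘ₗ N') (fun j => Sum.elim (fun μ => fgrad n' (liftEquiv (τ' μ) ι)) (fun μ => bgrad n' (liftEquiv (τ' μ) ι)) j ∘ₗ (mulOp (fun p : X' × ι => χtX' p.1) ∘ₗ N'))) V')) (commOp (-(((unstackM Cc Ac + NV ∘ₗ projO none) - mulOp (fun p :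 X × ι => ψX p.1) ∘ₗ (unstackM Cc Ac + NV ∘ₗ projO none) ∘ₗ mulOp (fun q : (X × ι) × Option (J ⊕ J) => χX q.1.1)) ∘ₗ stack LinearMap.id (fun j => Sum.elim (fun μ => fgrad n (liftEquiv (τ μ) ι)) (fun μ => bgrad n (liftEquiv (τ μ) ι)) j))) (fun p : X × ι => hX p.1) ∘ₗ (projO none ∘ₗ bgPropV (stack (mulOp (fun p : X × ι => χtX p.1) ∘ₗ N) (fun j => Sum.elim (fun μ => fgrad n (liftEquiv (τ μ) ι)) (fun μ => bgrad n (liftEquiv (τ μ) ι)) j ∘ₗ (mulOp (fun p : X × ι => χtX p.1) ∘ₗ N))) V)))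
      (fun y y' => ind S y' * ((θF * (1 * ((((m₀ + oχ * β) + (m₁ + o₁ * β₁ + ct * m₀ + o₂ * β)) * cr +
              1 * (((m₀ + oχ * β) + (m₁ + o₁ * β₁ + ct * m₀ + o₂ * β)) * cr) * (R * ((β + (β₁ + ct * β)) * (1 - (β + (β₁ + ct * β)) * (R * cr) * cr)⁻¹) * cr) +
            (β + (β₁ + ct * β)) * o * cr * ((β + (β₁ + ct * β)) * (1 - (β + (β₁ + ct * β)) * (R * cr) * cr)⁻¹) * cr) *
          (1 - 1 * ((β + (β₁ + ct * β)) * (R * cr) * cr))⁻¹) + (1 * ((β + (β₁ + ct * β)) * (1 - (β + (β₁ + ct * β)) * (R * cr) * cr)⁻¹)) * oo) * cr + rF * (1 * ((β + (β₁ + ct * β)) * (1 - (β + (β₁ + ct * β)) * (R * cr) * cr)⁻¹)) * cr) * Real.exp (-(ρ₃ * g.dist y y')))) := by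
  have hβb : 0 ≤ β + (β₁ + ct * β) := by positivity
  have hqi : 0 ≤ (1 - (β + (β₁ + ct * β)) * (R * cr) * cr)⁻¹ := inv_nonneg.2 (by linarith)
  have hq1 : 0 ≤ (1 - 1 * ((β + (β₁ + ct * β)) * (R * cr) * cr))⁻¹ := by rw [one_mul]; exact hqi
  have hB : 0 ≤ ((β + (β₁ + ct * β)) * (1 - (β + (β₁ + ct * β)) * (R * cr) * cr)⁻¹) := mul_nonneg hβb hqi
  have hAD : 0 ≤ ((((m₀ + oχ * β) + (m₁ + o₁ * β₁ + ct * m₀ + o₂ * β)) * cr +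
              1 * (((m₀ + oχ * β) + (m₁ + o₁ * β₁ + ct * m₀ + o₂ * β)) * cr) * (R * ((β + (β₁ + ct * β)) * (1 - (β + (β₁ + ct * β)) * (R * cr) * cr)⁻¹) * cr) +
            (β + (β₁ + ct * β)) * o * cr * ((β + (β₁ + ct * β)) * (1 - (β + (β₁ + ct * β)) * (R * cr) * cr)⁻¹) * cr) *
          (1 - 1 * ((β + (β₁ + ct * β)) * (R * cr) * cr))⁻¹) := by positivity
  have hG := hasMaj_smoothCut_flat blk (S := S) hβ hβ₁ hct hχt hsub hcut
  have hD := hasMaj_jet_smoothCut_flat blk τ n (S := S) hβ hβ₁ hct hχt hdχt hdχtb hs hsb hdd hddb hcut hcutF hcutB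
  have hG' := hasMaj_smoothCut_flat (blk ∘ π) (S := S) hβ hβ₁ hct hχt' hsub' hcut'
  have hD' := hasMaj_jet_smoothCut_flat (blk ∘ π) τ' n' (S := S) hβ hβ₁ hct hχt' hdχt' hdχtb' hs' hsb' hdd' hddb' hcut' hcutF' hcutB'
  have hunit := (hasMaj_dressedV_pair blk htri hd hrow hσ hβb hR hcr hσρ hρ₁V hρ₁G hρ₂ hρ₂₁ hG hD hV hq).1
  have hunit' := (hasMaj_dressedV_pair (blk ∘ π) htri hd hrow hσ hβb hR hcr hσρ hρ₁V hρ₁G hρ₂ hρ₂₁ hG' hD' hV' hq).1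
  have hS := jetCut_comp_jet_mulOp_comp τ n hχ hs2 hsb2 hdd2 hddb2 N
  rw [jet_comp_eq_stack] at hS
  have hS' := jetCut_comp_jet_mulOp_comp τ' n' hχ' hs2' hsb2' hdd2' hddb2' N'
  rw [jet_comp_eq_stack] at hS'
  have hYloc := jetCut_comp_jet_mulOp_comp τ n hχh hhs' hhsb' hhdd' hhddb' (projO none ∘ₗ bgPropV (stack (mulOp (fun p : X × ι => χtX p.1) ∘ₗ N) (fun j => Sum.elim (fun μ => fgrad n (liftEquiv (τ μ) ι)) (fun μ => bgrad n (liftEquiv (τ μ) ι)) j ∘ₗ (mulOp (fun p : X × ι => χtX p.1) ∘ₗ N))) V)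
  have hYloc' := jetCut_comp_jet_mulOp_comp τ' n' hχhf hhsf hhsbf hhddf hhddbf (projO none ∘ₗ bgPropV (stack (mulOp (fun p : X' × ι => χtX' p.1) ∘ₗ N') (fun j => Sum.elim (fun μ => fgrad n' (liftEquiv (τ' μ) ι)) (fun μ => bgrad n' (liftEquiv (τ' μ) ι)) j ∘ₗ (mulOp (fun p : X' × ι => χtX' p.1) ∘ₗ N'))) V')
  -- rows: X two-sided (file 34), 𝔇(X′,X) two-sided (file 35), M_{h′} ≤ 1, 𝔇(M_{h′},M_h) ≤ diag oo
  have hX0 := hasMaj_smoothCutDressed_loc₂ blk τ n htri hd hrow hσ hβ hβ₁ hct hR hcr hσρ hρ₁V hρ₁G hρ₂ hρ₂₁ hSχ hSψ hχt hdχt hdχtb hsub hχ hs hsb hdd hddb hNψ hcut hcutF hcutB hV hq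
  have hDX := hasMaj_idef_smoothCutDressed_loc₂ blk π τ τ' n n' htri hd hrow hσ hcr hβ hβ₁ hct hm₀ hm₁ hoχ ho₁ ho₂ hR ho hσρ hρ₁V hρ₁G hρ₂ hρ₂₁ hSχ hSψ hSχ' hSψ' hχt hdχt hdχtb hsub hχ hs hsb hdd hddb hNψ
    hχt' hdχt' hdχtb' hsub' hχ' hs' hsb' hdd' hddb' hNψ' hfitχ hfit₁ hfit₁b hfit₂ hfit₂b hcut hcutF hcutB hcut' hcutF' hcutB' hDcut hDcutF hDcutB hV hV' hDV hq
  have hMh : HasMaj (BlockNorm.ofBlocks g (liftBlk blk ι)) (BlockNorm.ofBlocks g (liftBlk blk ι)) (mulOp (fun p : X × ι => hX p.1)) (diagK fun _ => (1 : ℝ)) := hasMaj_mulOp (liftBlk blk ι) (fun _ => zero_le_one) fun p => hhabs p.1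
  have hMh' : HasMaj (BlockNorm.ofBlocks g (liftBlk (blk ∘ π) ι)) (BlockNorm.ofBlocks g (liftBlk (blk ∘ π) ι)) (mulOp (fun p : X' × ι => hX' p.1)) (diagK fun _ => (1 : ℝ)) := hasMaj_mulOp (liftBlk (blk ∘ π) ι) (fun _ => zero_le_one) fun p => hhabs' p.1
  have hDM : HasMaj (BlockNorm.ofBlocks g (liftBlk blk ι)) (BlockNorm.ofBlocks g (liftBlk (blk ∘ π) ι)) (idef (pull (liftMap π ι)) (pull (liftMap π ι)) (mulOp (fun p : X' × ι => hX' p.1)) (mulOp (fun p : X × ι => hX p.1))) (diagK fun _ => oo) :=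
    hasMaj_idef_mulOp (liftBlk blk ι) (liftMap π ι) (o := fun _ => oo) (fun _ => hoo) hfh
  have h2 := ((hasMaj_diag_comp (liftBlk (blk ∘ π) ι) (fun _ => zero_le_one) hMh' hDX).add (hasMaj_diag_comp (liftBlk blk ι) (fun _ => hoo) hDM hX0)).mono fun y y' =>
    (le_of_eq (by ring) : _ ≤ ind S y * ind S y' * ((1 * ((((m₀ + oχ * β) + (m₁ + o₁ * β₁ + ct * m₀ + o₂ * β)) * cr +
              1 * (((m₀ + oχ * β) + (m₁ + o₁ * β₁ + ct * m₀ + o₂ * β)) * cr) * (R * ((β + (β₁ + ct * β)) * (1 - (β + (β₁ + ct * β)) * (R * cr) * cr)⁻¹) * cr) +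
            (β + (β₁ + ct * β)) * o * cr * ((β + (β₁ + ct * β)) * (1 - (β + (β₁ + ct * β)) * (R * cr) * cr)⁻¹) * cr) *
          (1 - 1 * ((β + (β₁ + ct * β)) * (R * cr) * cr))⁻¹) + (1 * ((β + (β₁ + ct * β)) * (1 - (β + (β₁ + ct * β)) * (R * cr) * cr)⁻¹)) * oo) * Real.exp (-(ρ₂ * g.dist y y'))))
  have hY := (hasMaj_diag_comp (liftBlk blk ι) (fun _ => zero_le_one) hMh hX0).mono fun y y' =>
    (le_of_eq (by ring) : _ ≤ ind S y * ind S y' * ((1 * ((β + (β₁ + ct * β)) * (1 - (β + (β₁ + ct * β)) * (R * cr) * cr)⁻¹)) * Real.exp (-(ρ₂ * g.dist y y'))))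
  have t1 := hasMaj_comp_exp_in (liftBlk (blk ∘ π) ι) htri hd hrow hθF (add_nonneg (mul_nonneg zero_le_one hAD) (mul_nonneg (mul_nonneg zero_le_one hB) hoo)) hρ₃ hρ₃₂ hρF hfarN' h2
  have t2 := hasMaj_comp_exp_in (liftBlk blk ι) htri hd hrow hrF (mul_nonneg zero_le_one hB) hρ₃ hρ₃₂ hρF hDfarN hY
  refine hasMaj_idef_of_eq_neg_comp₃ (pull (liftMap π ι)) (commOp_farDefect_structural_eq (fun _ => rfl) hunit' hS' hhψf (unstackM Cc' Ac' + NV' ∘ₗ projO none) (farPart_structural Cc' Ac' NV' χX' ψX' hψχf) hYloc')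
    (commOp_farDefect_structural_eq (fun _ => rfl) hunit hS hhψ (unstackM Cc Ac + NV ∘ₗ projO none) (farPart_structural Cc Ac NV χX ψX hψχ) hYloc) ((t1.add t2).mono fun y y' => le_of_eq ?_)
  ring

/-- ★ `𝔇(M_{h′}F′X′, M_hFX) = 0` (both vanish by file 49 `mulOp_comp_farDefect_comp_dressed`): file 48's `hDFX` row with `r_{FE} = 0`. [cite: Balaban1985BackgroundPropagators, (3.63)–(3.65) pp.402–403 (mechanism)] -/
theorem hasMaj_idef_mulOp_farDefect_structural
    (htri : Triangle254 g) (hd : ∀ a b : g.Site, 0 ≤ g.dist a b) (hrow : RowSum g σ cr) (hσ : 0 ≤ σ) {ρ₁ ρ₂ δV R : ℝ} (hβ : 0 ≤ β) (hβ₁ : 0 ≤ β₁)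
    (hct : 0 ≤ ct) (hR : 0 ≤ R) (hcr : 0 ≤ cr) (hσρ : σ ≤ ρ₁) (hρ₁V : ρ₁ ≤ δV) (hρ₁G : ρ₁ + σ ≤ δ) (hρ₂ : 0 ≤ ρ₂) (hρ₂₁ : ρ₂ + σ ≤ ρ₁)
    (hχt : ∀ x, |χtX x| ≤ 1)
    (hdχt : ∀ μ p, |fgrad n (liftEquiv (τ μ) ι) (fun p : X × ι => χtX p.1) p| ≤ ct) (hdχtb : ∀ μ p, |bgrad n (liftEquiv (τ μ) ι) (fun p : X × ι => χtX p.1) p| ≤ ct)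
    (hsub : mulOp (fun p : X × ι => χtX p.1) ∘ₗ mulOp (fun p : X × ι => χX p.1) = mulOp (fun p : X × ι => χtX p.1))
    (hχ : mulOp (fun p : X × ι => χX p.1) ∘ₗ mulOp (fun p : X × ι => χtX p.1) = mulOp (fun p : X × ι => χtX p.1))
    (hs : ∀ μ, mulOp ((fun p : X × ι => χtX p.1) ∘ (liftEquiv (τ μ) ι)) ∘ₗ mulOp (fun p : X × ι => χX p.1) = mulOp ((fun p : X × ι => χtX p.1) ∘ (liftEquiv (τ μ) ι)))
    (hsb : ∀ μ, mulOp ((fun p : X × ι => χtX p.1) ∘ (liftEquiv (τ μ) ι).symm) ∘ₗ mulOp (fun p : X × ι => χX p.1) = mulOp ((fun p : X × ι => χtX p.1) ∘ (liftEquiv (τ μ) ι).symm))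
    (hdd : ∀ μ, mulOp (fgrad n (liftEquiv (τ μ) ι) (fun p : X × ι => χtX p.1)) ∘ₗ mulOp (fun p : X × ι => χX p.1) = mulOp (fgrad n (liftEquiv (τ μ) ι) (fun p : X × ι => χtX p.1)))
    (hddb : ∀ μ, mulOp (bgrad n (liftEquiv (τ μ) ι) (fun p : X × ι => χtX p.1)) ∘ₗ mulOp (fun p : X × ι => χX p.1) = mulOp (bgrad n (liftEquiv (τ μ) ι) (fun p : X × ι => χtX p.1)))
    (hs2 : ∀ μ, mulOp (fun p : X × ι => χX p.1) ∘ₗ mulOp ((fun p : X × ι => χtX p.1) ∘ (liftEquiv (τ μ) ι)) = mulOp ((fun p : X × ι => χtX p.1) ∘ (liftEquiv (τ μ) ι)))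
    (hsb2 : ∀ μ, mulOp (fun p : X × ι => χX p.1) ∘ₗ mulOp ((fun p : X × ι => χtX p.1) ∘ (liftEquiv (τ μ) ι).symm) = mulOp ((fun p : X × ι => χtX p.1) ∘ (liftEquiv (τ μ) ι).symm))
    (hdd2 : ∀ μ, mulOp (fun p : X × ι => χX p.1) ∘ₗ mulOp (fgrad n (liftEquiv (τ μ) ι) (fun p : X × ι => χtX p.1)) = mulOp (fgrad n (liftEquiv (τ μ) ι) (fun p : X × ι => χtX p.1)))
    (hddb2 : ∀ μ, mulOp (fun p : X × ι => χX p.1) ∘ₗ mulOp (bgrad n (liftEquiv (τ μ) ι) (fun p : X × ι => χtX p.1)) = mulOp (bgrad n (liftEquiv (τ μ) ι) (fun p : X × ι => χtX p.1)))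
    (hcut : HasMaj (BlockNorm.ofBlocks g (liftBlk blk ι)) (BlockNorm.ofBlocks g (liftBlk blk ι)) (mulOp (fun p : X × ι => χX p.1) ∘ₗ N) (fun y y' => ind S y * ind S y' * (β * Real.exp (-(δ * g.dist y y')))))
    (hcutF : ∀ μ, HasMaj (BlockNorm.ofBlocks g (liftBlk blk ι)) (BlockNorm.ofBlocks g (liftBlk blk ι)) (mulOp (fun p : X × ι => χX p.1) ∘ₗ (fgrad n (liftEquiv (τ μ) ι) ∘ₗ N)) (fun y y' => ind S y * ind S y' * (β₁ * Real.exp (-(δ * g.dist y y')))))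
    (hcutB : ∀ μ, HasMaj (BlockNorm.ofBlocks g (liftBlk blk ι)) (BlockNorm.ofBlocks g (liftBlk blk ι)) (mulOp (fun p : X × ι => χX p.1) ∘ₗ (bgrad n (liftEquiv (τ μ) ι) ∘ₗ N)) (fun y y' => ind S y * ind S y' * (β₁ * Real.exp (-(δ * g.dist y y')))))
    (hV : HasMaj (BlockNorm.ofBlocks g (blkPair (liftBlk blk ι))) (BlockNorm.ofBlocks g (liftBlk blk ι)) V (fun y y' => R * Real.exp (-(δV * g.dist y y'))))
    (hq : (β + (β₁ + ct * β)) * (R * cr) * cr < 1)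
    -- fine grid
    (hχt' : ∀ x', |χtX' x'| ≤ 1)
    (hdχt' : ∀ μ p', |fgrad n' (liftEquiv (τ' μ) ι) (fun p' : X' × ι => χtX' p'.1) p'| ≤ ct) (hdχtb' : ∀ μ p', |bgrad n' (liftEquiv (τ' μ) ι) (fun p' : X' × ι => χtX' p'.1) p'| ≤ ct)
    (hsub' : mulOp (fun p : X' × ι => χtX' p.1) ∘ₗ mulOp (fun p : X' × ι => χX' p.1) = mulOp (fun p : X' × ι => χtX' p.1))
    (hχ' : mulOp (fun p : X' × ι => χX' p.1) ∘ₗ mulOp (fun p : X' × ι => χtX' p.1) = mulOp (fun p : X' × ι => χtX' p.1))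
    (hs' : ∀ μ, mulOp ((fun p' : X' × ι => χtX' p'.1) ∘ (liftEquiv (τ' μ) ι)) ∘ₗ mulOp (fun p' : X' × ι => χX' p'.1) = mulOp ((fun p' : X' × ι => χtX' p'.1) ∘ (liftEquiv (τ' μ) ι)))
    (hsb' : ∀ μ, mulOp ((fun p' : X' × ι => χtX' p'.1) ∘ (liftEquiv (τ' μ) ι).symm) ∘ₗ mulOp (fun p' : X' × ι => χX' p'.1) = mulOp ((fun p' : X' × ι => χtX' p'.1) ∘ (liftEquiv (τ' μ) ι).symm))
    (hdd' : ∀ μ, mulOp (fgrad n' (liftEquiv (τ' μ) ι) (fun p' : X' × ι => χtX' p'.1)) ∘ₗ mulOp (fun p' : X' × ι => χX' p'.1) = mulOp (fgrad n' (liftEquiv (τ' μ) ι) (fun p' : X' × ι => χtX' p'.1)))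
    (hddb' : ∀ μ, mulOp (bgrad n' (liftEquiv (τ' μ) ι) (fun p' : X' × ι => χtX' p'.1)) ∘ₗ mulOp (fun p' : X' × ι => χX' p'.1) = mulOp (bgrad n' (liftEquiv (τ' μ) ι) (fun p' : X' × ι => χtX' p'.1)))
    (hs2' : ∀ μ, mulOp (fun p : X' × ι => χX' p.1) ∘ₗ mulOp ((fun p : X' × ι => χtX' p.1) ∘ (liftEquiv (τ' μ) ι)) = mulOp ((fun p : X' × ι => χtX' p.1) ∘ (liftEquiv (τ' μ) ι)))
    (hsb2' : ∀ μ, mulOp (fun p : X' × ι => χX' p.1) ∘ₗ mulOp ((fun p : X' × ι => χtX' p.1) ∘ (liftEquiv (τ' μ) ι).symm) = mulOp ((fun p : X' × ι => χtX' p.1) ∘ (liftEquiv (τ' μ) ι).symm))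
    (hdd2' : ∀ μ, mulOp (fun p : X' × ι => χX' p.1) ∘ₗ mulOp (fgrad n' (liftEquiv (τ' μ) ι) (fun p : X' × ι => χtX' p.1)) = mulOp (fgrad n' (liftEquiv (τ' μ) ι) (fun p : X' × ι => χtX' p.1)))
    (hddb2' : ∀ μ, mulOp (fun p : X' × ι => χX' p.1) ∘ₗ mulOp (bgrad n' (liftEquiv (τ' μ) ι) (fun p : X' × ι => χtX' p.1)) = mulOp (bgrad n' (liftEquiv (τ' μ) ι) (fun p : X' × ι => χtX' p.1)))
    (hcut' : HasMaj (BlockNorm.ofBlocks g (liftBlk (blk ∘ π) ι)) (BlockNorm.ofBlocks g (liftBlk (blk ∘ π) ι)) (mulOp (fun p : X' × ι => χX' p.1) ∘ₗ N') (fun y y' => ind S y * ind S y' * (β * Real.exp (-(δ * g.dist y y')))))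
    (hcutF' : ∀ μ, HasMaj (BlockNorm.ofBlocks g (liftBlk (blk ∘ π) ι)) (BlockNorm.ofBlocks g (liftBlk (blk ∘ π) ι)) (mulOp (fun p : X' × ι => χX' p.1) ∘ₗ (fgrad n' (liftEquiv (τ' μ) ι) ∘ₗ N')) (fun y y' => ind S y * ind S y' * (β₁ * Real.exp (-(δ * g.dist y y')))))
    (hcutB' : ∀ μ, HasMaj (BlockNorm.ofBlocks g (liftBlk (blk ∘ π) ι)) (BlockNorm.ofBlocks g (liftBlk (blk ∘ π) ι)) (mulOp (fun p : X' × ι => χX' p.1) ∘ₗ (bgrad n' (liftEquiv (τ' μ) ι) ∘ₗ N')) (fun y y' => ind S y * ind S y' * (β₁ * Real.exp (-(δ * g.dist y y')))))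
    (hV' : HasMaj (BlockNorm.ofBlocks g (blkPair (liftBlk (blk ∘ π) ι))) (BlockNorm.ofBlocks g (liftBlk (blk ∘ π) ι)) V' (fun y y' => R * Real.exp (-(δV * g.dist y y'))))
    (hhψ : mulOp (fun p : X × ι => hX p.1) ∘ₗ mulOp (fun p : X × ι => ψX p.1) = mulOp (fun p : X × ι => hX p.1)) (hhψf : mulOp (fun p : X' × ι => hX' p.1) ∘ₗ mulOp (fun p : X' × ι => ψX' p.1) = mulOp (fun p : X' × ι => hX' p.1)) (ρ₃ : ℝ) :
    HasMaj (BlockNorm.ofBlocks g (liftBlk blk ι)) (BlockNorm.ofBlocks g (liftBlk (blk ∘ π) ι)) (idef (pull (liftMap π ι)) (pull (liftMap π ι)) (mulOp (fun p : X' × ι => hX' p.1) ∘ₗ (-(((unstackM Cc' Ac' + NV' ∘ₗ projO none) - mulOp (fun p : X' × ι => ψX' p.1) ∘ₗ (unstackM Cc' Ac' + NV' ∘ₗ projO none) ∘ₗ mulOp (fun q : (X' × ι) × Option (J ⊕ J) => χX' q.1.1)) ∘ₗ stack LinearMap.id (fun j => Sum.elim (fun μ => fgrad n' (liftEquiv (τ'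 μ) ι)) (fun μ => bgrad n' (liftEquiv (τ' μ) ι)) j))) ∘ₗ (projO none ∘ₗ bgPropV (stack (mulOp (fun p : X' × ι => χtX' p.1) ∘ₗ N') (fun j => Sum.elim (fun μ => fgrad n' (liftEquiv (τ' μ) ι)) (fun μ => bgrad n' (liftEquiv (τ' μ) ι)) j ∘ₗ (mulOp (fun p : X' × ι => χtX' p.1) ∘ₗ N'))) V')) (mulOp (fun p : X × ι => hX p.1) ∘ₗ (-(((unstackM Cc Ac + NV ∘ₗ projO none) - mulOp (fun p : X × ι => ψX p.1) ∘ₗ (unstackM Cc Ac + NV ∘ₗ projO none) ∘ₗ mulOp (fun q : (X × ι) × Option (J ⊕ J) => χX q.1.1)) ∘ₗ stack LinearMap.id (fun j => Sum.elim (fun μ => fgrad n (liftEquiv (τ μ) ι)) (fun μ => bgrad n (liftEquiv (τ μ) ι)) j))) ∘ₗ (projO none ∘ₗ bgPropV (stack (mulOp (fun p : X × ι => χtX p.1) ∘ₗ N) (fun j => Sum.elim (fun μ => fgrad n (liftEquiv (τ μ) ι)) (fun μ => bgrad n (liftEquiv (τ μ) ι)) j ∘ₗ (mulOp (fun p : X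 × ι => χtX p.1) ∘ₗ N))) V)))
      (fun y y' => ind S y * (0 * Real.exp (-(ρ₃ * g.dist y y')))) := by
  have hβb : 0 ≤ β + (β₁ + ct * β) := by positivity
  have hG := hasMaj_smoothCut_flat blk (S := S) hβ hβ₁ hct hχt hsub hcut
  have hD := hasMaj_jet_smoothCut_flat blk τ n (S := S) hβ hβ₁ hct hχt hdχt hdχtb hs hsb hdd hddb hcut hcutF hcutB
  have hG' := hasMaj_smoothCut_flat (blk ∘ π) (S := S) hβ hβ₁ hct hχt' hsub' hcut'
  have hD' := hasMaj_jet_smoothCut_flat (blk ∘ π) τ' n' (S := S) hβ hβ₁ hct hχt' hdχt' hdχtb' hs' hsb' hdd' hddb' hcut' hcutF' hcutB'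
  have hunit := (hasMaj_dressedV_pair blk htri hd hrow hσ hβb hR hcr hσρ hρ₁V hρ₁G hρ₂ hρ₂₁ hG hD hV hq).1
  have hunit' := (hasMaj_dressedV_pair (blk ∘ π) htri hd hrow hσ hβb hR hcr hσρ hρ₁V hρ₁G hρ₂ hρ₂₁ hG' hD' hV' hq).1
  have hS := jetCut_comp_jet_mulOp_comp τ n hχ hs2 hsb2 hdd2 hddb2 N
  rw [jet_comp_eq_stack] at hS
  have hS' := jetCut_comp_jet_mulOp_comp τ' n' hχ' hs2' hsb2' hdd2' hddb2' N'
  rw [jet_comp_eq_stack] at hS'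
  exact hasMaj_idef_of_eq_zero (pull (liftMap π ι)) (mulOp_comp_farDefect_comp_dressed (fun _ => rfl) hunit' hS' hhψf (unstackM Cc' Ac' + NV' ∘ₗ projO none)) (mulOp_comp_farDefect_comp_dressed (fun _ => rfl) hunit hS hhψ (unstackM Cc Ac + NV ∘ₗ projO none))
    fun y y' => le_of_eq (by ring)

end Rows

end Summit.QuantumFields.YangMills.BalabanUVNodes.N15.CurvedSpecies

end
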